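import Mathlib.Algebra.Field.ULift
import Mathlib.Algebra.Ring.Aut
import Literature.IUT.HodgeTheaters.GlobalFrobenioidsInfKappa
import HarnessLib

/-!
# [IUTchI] Ex 5.1 (v) — NON-VACUITY of `ModSolReconstruction` (the "functorial algorithm" record reconstructing `†𝕄^⊛_mod ⊆ †𝕄^⊛_sol`) (row «NV-L5/ModSolReconstruction»)

Mochizuki, *Inter-universal Teichmüller theory I*, kurims manuscript (May 2020), Example 5.1 (v), p. 129
(second display): "by restricting Kummer classes … to subgroups of `π₁^{κ-sol}(†𝒟^⊛)` that correspond to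
decomposition groups of non-critical `F_mod`-, `F_sol`-valued points of `C_{F_mod}`, we obtain a functorial algorithm
for reconstructing the monoids with `π₁^{κ-sol}(†𝒟^⊛)`-action `†𝕄^⊛_mod, †𝕄^⊛_sol`, together with the
field structure on `†𝕄^⊛_mod ∪ {0}, †𝕄^⊛_sol ∪ {0}`, from the ∞κ-coric structure associated to `†ℱ^⊛`."
([IUTchI] Ex 5.1 (v) p.129) [claim: Mochizuki2012, status: disputed]

PROOF-ONLY companion (no `def`, no `instance`, no `structure`) of abc-iut-L5-t1's `GlobalFrobenioidsInfKappa.lean`,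
where the algorithm is typed as the DATA record `ModSolReconstruction Γ` (a field `K P` with `Γ`-action and a subfield
`Kmod P` for every input pair `P : CoricPair Γ`, functorial in isomorphisms of `P`) with the comparison predicate
`ModSolReconstruction.RecoversModel N A model`.  abc-iut-w5-d197's INHABITATION CENSUS L5 v1 lists
`ModSolReconstruction` with ZERO producers.  This file records, kernel-checked:

* `ModSolReconstruction.nonempty_degenerate` — `_degenerate` (flagged): for EVERY topological group `Γ` the record is
  inhabited by the constant algorithm returning `ℚ` with the trivial action and `Kmod = ⊤` («type is inhabited»,
  nothing more);
* `ModSolReconstruction.exists_parameterRecord_recoversModel` — `_parameterRecord`: over the Example 5.1 (i) data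
  `N : NFBridgeRecon` (abc-iut-L5-t1), the algorithm that returns, for every input, the very comparison field of the
  predicate — the fixed field `𝕄̄^⊛_sol(†𝒟^⊚) = F̄^{π₁^{rat/κ-sol}}` with its `π₁^rat(†𝒟^⊛)`-action through
  `π₁^rat ↠ π₁(†𝒟^⊛)` (well defined because `π₁^{rat/κ-sol}` is NORMAL, `NFBridgeRecon.ratKsolKer_normal`) and
  `Kmod :=` the trace of `𝕄̄^⊛_mod(†𝒟^⊚)` (`NFBridgeRecon.MbarMod`) — inhabits `ModSolReconstruction N.piRat` AND
  satisfies `RecoversModel N A model` for EVERY `model` (comparison isomorphism `= id`).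

HONEST LABEL / SCOPE (neutral, for the interface owner and for plan §4(iii)): both inhabitants are CONSTANT in the
input pair `P`; the second is built from `N`'s own data, not from `P` via Kummer classes, so it witnesses exactly
«the record type and the comparison predicate are jointly satisfiable at the Example 5.1 (i) data» — it is NOT the
printed reconstruction (whose content, [AbsTopIII] Thm 1.9, is campaign-L and is the subject of GAP row G-w4d056-2 /
SUBDAG-IUTchI-Ex51), and it shows that `RecoversModel` alone does not force an algorithm to read its input.
Nothing of [IUTchI] is asserted; instantiated ≠ endorsed; no side is taken on [IUTchIII] Cor. 3.12.
-/

noncomputable section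

namespace Literature.IUT.HodgeTheaters

namespace ModSolReconstruction

universe u

/-- **IUTchI:Ex5.1(v)** (kurims p.129, second display) `_degenerate` (flagged; «type is inhabited» only): for every
topological group `Γ` the record `ModSolReconstruction Γ` is inhabited — constant field `ℚ`, trivial `Γ`-action,
`Kmod = ⊤`, identity transition isomorphisms. [claim: Mochizuki2012, status: disputed] -/
theorem nonempty_degenerate (Γ : Type u) [Group Γ] [TopologicalSpace Γ] : Nonempty (ModSolReconstruction Γ) := by
  letI : MulSemiringAction Γ (ULift.{u} ℚ) :=
    MulSemiringAction.compHom (ULift.{u} ℚ) (1 : Γ →* RingAut (ULift.{u} ℚ))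
  exact ⟨{ K := fun _ => ULift.{u} ℚ
           Kmod := fun _ => ⊤
           map := fun _ => RingEquiv.refl _
           map_smul := fun _ _ _ => rfl
           map_mem := fun _ _ => iff_of_true (Subfield.mem_top _) (Subfield.mem_top _) }⟩

variable (N : NFBridgeRecon.{u})

/-- The comparison field of `RecoversModel` — `𝕄̄^⊛_sol(†𝒟^⊚) ∪ {0}`, the fixed field in `𝕄̄^⊛(†𝒟^⊚)` of the image of
`π₁^{rat/κ-sol}(†𝒟^⊛)` — is stable under ALL of `π₁^rat(†𝒟^⊛)` acting through `π₁^rat ↠ π₁(†𝒟^⊛)`, because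
`π₁^{rat/κ-sol}` is normal (`NFBridgeRecon.ratKsolKer_normal`): `h·(g·x) = g·((g⁻¹hg)·x) = g·x`.
([IUTchI] Ex 5.1 (i) p.124: `π₁^{κ-sol}(†𝒟^⊛) := π₁^rat/π₁^{rat/κ-sol}` is a QUOTIENT group.)
[claim: Mochizuki2012, status: disputed] -/
theorem ratToAst_smul_mem_fixedSubfield (g : N.piRat) {x : N.Fbar}
    (hx : x ∈ FixedPoints.subfield (N.ratKsolKer.map N.ratToAst.toMonoidHom) N.Fbar) :
    N.ratToAst g • x ∈ FixedPoints.subfield (N.ratKsolKer.map N.ratToAst.toMonoidHom) N.Fbar := by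
  -- membership in the fixed field = fixed by every element of the subgroup
  change ∀ m : ↥(N.ratKsolKer.map N.ratToAst.toMonoidHom), m • (N.ratToAst g • x) = N.ratToAst g • x
  have hx' : ∀ m : ↥(N.ratKsolKer.map N.ratToAst.toMonoidHom), m • x = x := hx
  rintro ⟨m, hm⟩
  obtain ⟨h, hh, rfl⟩ := hm
  -- `g⁻¹ h g ∈ π₁^{rat/κ-sol}` by normality
  have hconj : g⁻¹ * h * g ∈ N.ratKsolKer := by
    simpa using N.ratKsolKer_normal.conj_mem h hh g⁻¹
  have hfix := hx' ⟨N.ratToAst.toMonoidHom (g⁻¹ * h * g), ⟨_, hconj, rfl⟩⟩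
  change N.ratToAst (g⁻¹ * h * g) • x = x at hfix
  change N.ratToAst h • (N.ratToAst g • x) = N.ratToAst g • x
  calc N.ratToAst h • (N.ratToAst g • x)
      = N.ratToAst g • (N.ratToAst (g⁻¹ * h * g) • x) := by
          rw [← mul_smul, ← mul_smul, ← map_mul, ← map_mul]
          congr 2
          group
    _ = N.ratToAst g • x := by rw [hfix]

/-- **IUTchI:Ex5.1(v)** (kurims p.129, second display) `_parameterRecord`: over the Example 5.1 (i) data
`N : NFBridgeRecon` there is an inhabitant `A : ModSolReconstruction π₁^rat(†𝒟^⊛)` — returning, for every input pair,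
the fixed field `𝕄̄^⊛_sol(†𝒟^⊚) ∪ {0}` with its `π₁^rat`-action and `Kmod :=` the trace of `𝕄̄^⊛_mod(†𝒟^⊚) ∪ {0}`
(`NFBridgeRecon.MbarMod`), identity transition isomorphisms — which SATISFIES the typed comparison
`A.RecoversModel N model` for EVERY `model : CoricPair π₁^rat` (comparison isomorphism `= id`).  CONSTANT in the
input: witnesses joint satisfiability of record + predicate at the (i)-data, not the printed Kummer-theoretic
reconstruction. [claim: Mochizuki2012, status: disputed] -/
theorem exists_parameterRecord_recoversModel :
    ∃ A : ModSolReconstruction N.piRat, ∀ model : CoricPair N.piRat, A.RecoversModel N model := by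
  let S : Subfield N.Fbar := FixedPoints.subfield (N.ratKsolKer.map N.ratToAst.toMonoidHom) N.Fbar
  -- the `π₁^rat`-action on `↥S` through `π₁^rat ↠ π₁(†𝒟^⊛)`
  letI act : MulSemiringAction N.piRat ↥S :=
    { smul := fun g x => ⟨N.ratToAst g • (x : N.Fbar), ratToAst_smul_mem_fixedSubfield N g x.2⟩
      one_smul := fun x => Subtype.ext (by
        change N.ratToAst 1 • (x : N.Fbar) = x
        rw [map_one, one_smul])
      mul_smul := fun g h x => Subtype.ext (by
        change N.ratToAst (g * h) • (x : N.Fbar) = N.ratToAst g • (N.ratToAst h • (x : N.Fbar))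
        rw [map_mul, mul_smul])
      smul_zero := fun g => Subtype.ext (by
        change N.ratToAst g • ((0 : ↥S) : N.Fbar) = ((0 : ↥S) : N.Fbar)
        rw [ZeroMemClass.coe_zero, smul_zero])
      smul_add := fun g x y => Subtype.ext (by
        change N.ratToAst g • ((x + y : ↥S) : N.Fbar) =
          ((⟨N.ratToAst g • (x : N.Fbar), ratToAst_smul_mem_fixedSubfield N g x.2⟩ : ↥S) +
            ⟨N.ratToAst g • (y : N.Fbar), ratToAst_smul_mem_fixedSubfield N g y.2⟩ : ↥S)
        rw [AddMemClass.coe_add, smul_add]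
        rfl)
      smul_one := fun g => Subtype.ext (by
        change N.ratToAst g • ((1 : ↥S) : N.Fbar) = ((1 : ↥S) : N.Fbar)
        rw [OneMemClass.coe_one, smul_one])
      smul_mul := fun g x y => Subtype.ext (by
        change N.ratToAst g • ((x * y : ↥S) : N.Fbar) =
          ((⟨N.ratToAst g • (x : N.Fbar), ratToAst_smul_mem_fixedSubfield N g x.2⟩ : ↥S) *
            ⟨N.ratToAst g • (y : N.Fbar), ratToAst_smul_mem_fixedSubfield N g y.2⟩ : ↥S)
        rw [MulMemClass.coe_mul, smul_mul']
        rfl) }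
  refine ⟨{ K := fun _ => ↥S
            Kmod := fun _ => N.MbarMod.comap S.subtype
            map := fun _ => RingEquiv.refl _
            map_smul := fun _ _ _ => rfl
            map_mem := fun _ _ => Iff.rfl }, fun model => ⟨⟨RingEquiv.refl _, fun _ _ => rfl, fun _ => Iff.rfl⟩⟩⟩

/-- Hence, in particular, the `_parameterRecord` inhabitant: `ModSolReconstruction π₁^rat(†𝒟^⊛)` is nonempty over every
Example 5.1 (i) datum `N`. [claim: Mochizuki2012, status: disputed] -/
theorem nonempty_parameterRecord : Nonempty (ModSolReconstruction N.piRat) := by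
  obtain ⟨A, -⟩ := exists_parameterRecord_recoversModel N
  exact ⟨A⟩

/-- … and for every input pair the comparison predicate `RecoversModel` is satisfiable (by the same constant
algorithm): the typed predicate alone does not force an algorithm to read its input — the printed reconstruction's
content (restriction of Kummer classes to decomposition groups, [AbsTopIII] Thm 1.9) lies beyond it (cf. GAP row
G-w4d056-2 / SUBDAG-IUTchI-Ex51). [claim: Mochizuki2012, status: disputed] -/
theorem exists_recoversModel (model : CoricPair N.piRat) :
    ∃ A : ModSolReconstruction N.piRat, A.RecoversModel N model := by
  obtain ⟨A, hA⟩ := exists_parameterRecord_recoversModel N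
  exact ⟨A, hA model⟩

end ModSolReconstruction

end Literature.IUT.HodgeTheaters

end
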